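import Summits.CriticalPhenomena.SAWScalingLimit.Theorems.SAWLoopFugacityFlowSimpleSubseqLimitsTransferCore
import Summits.CriticalPhenomena.SAWScalingLimit.Theses.SAWExcursionCardy
import HarnessLib

/-!
# Split glue for the crux `SimpleSubseqLimits` (stmt-CriticalPhenomena-4514) on route SAWExcursionCardy:
# `SeqSlitAvoidance → LimitRangeArc → SimpleSubseqLimits` (crux strategist, BC2-redirect seat, session B, 2026-08-17)

The shared crux item stmt-CriticalPhenomena-4514 (`SAWExcursionCardy.SimpleSubseqLimits`, also wanted by
SAWStressTensor and SAWQuadrupoleWard) is, verbatim, the landed core `Negative.SimpleSubseqLimitsCore` of its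
sister item stmt-CriticalPhenomena-4982 (`excursionCardy_iff_core`, `Iff.rfl`). The live line of the sister
(`slit-continuous-restriction`, lead c9; `…TransferCore.lean`, `…SlitLine.lean`) proves
`SequentialSlitAvoidance → AvoidanceLimit → SAWLoopFugacityFlow.SimpleSubseqLimits`, using its valued A-side
ONLY through SHAPE = `PastShadowing.Main.RangeArc` (`ν`-a.e. the RANGE of a subsequential limit is a simple arc
from `a` to `b` meeting `∂D` only at `a, b`; obtained there by `rangeArc_of_avoidanceValues`, inside
`stub_transferCore` for the admissibility of limit pasts and inside the closing for the boundary clause). The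
observable routes wanting stmt-4514 have no restriction item at all, so SHAPE is not free there. This file
re-hosts c9's transfer (`Transfer.stub_transferCore`, p153873) and closing (`Line.core_of_farReturnNull`,
p154999) VERBATIM on the value-free, order-blind HYPOTHESIS `RangeArc` (c9's cover and lattice lemmas
`Transfer.exists_cover`, `exists_pos_forall_le`, `law_conf_le` are imported, not restated) and lands the glue

  `SimpleSubseqLimits_of_arcSubs : ⟨SequentialSlitAvoidance, route-file text⟩ →
      ⟨RangeArc, route-file text⟩ → SAWExcursionCardy.SimpleSubseqLimits`

(registered stub of stmt-4514), consumed by `ledger route edit … --split SimpleSubseqLimits --glue-by`. Both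
antecedents are written in the route file's vocabulary; the first IS `Transfer.SequentialSlitAvoidance`
(`seqSlitText_iff`, `Iff.rfl`; the text of item stmt-CriticalPhenomena-18169), the second IS `RangeArc`
(`rangeArcText_iff`, `Iff.rfl`). `rangeArc_of_core` records that the SHAPE child is a CONSEQUENCE of the crux,
and `core_of_seqSlitAvoidance_rangeArc` (conclusion `Negative.SimpleSubseqLimitsCore`) is the route-neutral form
the sibling routes cite in one line. First prepared by strategist s2 for route SAWTensorRG (evidence
`SAWTensorRGSimpleSubseqLimitsSplit.lean`, namespace `…ArcSplit`); this file uses `…ArcSplitEC`. Credit: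
prover-line-stmt-CriticalPhenomena-4982-c9-0, planner-cstrat-stmt-CriticalPhenomena-4982-s2-0. [folklore]
-/

noncomputable section

open MeasureTheory Filter Topology Set Metric Function
open Literature.Probability.RandomPlanarGeometry Literature.Probability.RandomPlanarGeometry.SAW
open Literature.Probability.LatticeModels
open scoped ENNReal NNReal BoundedContinuousFunction unitInterval

namespace Summit.CriticalPhenomena.SAWScalingLimit.Theorems.SimpleSubseqLimits.SlitRestriction.ArcSplitEC

open Summit.CriticalPhenomena.SAWScalingLimit.Theorems.SimpleSubseqLimits.Negative
  (WeakLimitAlong SimpleSubseqLimitsCore simpleSubseqLimits_iff_core ae_source_target_range_of_weakLimitAlong)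
open Summit.CriticalPhenomena.SAWScalingLimit.Theorems.SimpleSubseqLimits.MarkedPointRevisit.Passage
  (IsSubseqLimit latticeCurve measure_image_mk_le_limsup_law)
open Summit.CriticalPhenomena.SAWScalingLimit.Theorems.SimpleSubseqLimits.FirstHit.Passage
  (gaussRat countable_gaussRat)
open Summit.CriticalPhenomena.SAWScalingLimit.Theorems.SimpleSubseqLimits.FarPast.Passage
  (farReturnEvent mem_simple_of_forall_notMem_farReturnEvent)
open Summit.CriticalPhenomena.SAWScalingLimit.Theorems.SimpleSubseqLimits.SlitRestriction.Lattice
  (prefixEvent approachEvent LatticeBound stub_latticeBound)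
open Summit.CriticalPhenomena.SAWScalingLimit.Theorems.SimpleSubseqLimits.SlitRestriction.Timing
  (vertexTime PrefixTiming stub_prefixTiming)
open Summit.CriticalPhenomena.SAWScalingLimit.Theorems.SimpleSubseqLimits.SlitRestriction.Pasts
  (truncate pastSet PastsCompact stub_pastsCompact)
open Summit.CriticalPhenomena.SAWScalingLimit.Theorems.SimpleSubseqLimits.SlitRestriction.Arc
  (IsAdmissiblePast SubArc stub_subArc)
open Summit.CriticalPhenomena.SAWScalingLimit.Theorems.SimpleSubseqLimits.SlitRestriction.Endpoints
  (OffTargetFarReturn offTargetFarReturnEvent FarReturnNullOffTarget FarReturnNull stub_endpoints)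
open Summit.CriticalPhenomena.SAWScalingLimit.Theorems.SimpleSubseqLimits.SlitRestriction.Transfer
  (farPast SequentialSlitAvoidance LocallyUniformSlitAvoidance locallyUniform_of_sequential
    farPast_subset_thickening_of_dist_lt Conf isOpen_setOf_conf conf_of_return latticeEvent_of_conf
    exists_cover exists_pos_forall_le law_conf_le)
open Summit.CriticalPhenomena.SAWScalingLimit.Theorems.SimpleSubseqLimits.PastShadowing.Main (RangeArc)

/-! ## The soft transfer on the SHAPE input `RangeArc` -/

/-- **THE SOFT TRANSFER on the value-free SHAPE input** (lead c9's `Transfer.stub_transferCore`,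
p153873, verbatim with `RangeArc` replacing `rangeArc_of_avoidanceValues hAV`): the four landed helper
statements, sequential slit avoidance and SHAPE give off-target far-return nullity under every
subsequential weak limit of the critical SAW laws. Steps: (1) sequential ⇒ locally uniform; (2) good
classes (`source/target/range`, SHAPE) fill a measurable full-measure set; (3) Ulam tightness gives a
compact core `K`; (4) the compact set of admissible pasts of `K` and its finite cover by the locally uniform
bound; (5) the event core lies in the OPEN squeeze configuration, portmanteau; (6) the lattice bound with
the one-element assignment; (7) `ν E ≤ α` for every `α > 0`. [folklore] -/
theorem transferCore_of_rangeArc : LatticeBound → PrefixTiming → PastsCompact → SubArc →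
    SequentialSlitAvoidance → RangeArc → FarReturnNullOffTarget := by
  intro hLB _hPT hPC hSA hSeq hRA D a b s ν hab hL q r η hr hη
  obtain ⟨hs, hν, hw⟩ := hL
  haveI := hν
  have hU := locallyUniform_of_sequential hSeq
  -- (2) the measurable full-measure set of good classes
  have hfree := ae_source_target_range_of_weakLimitAlong (ν := ν) hab hs hw
  have hshape := hRA D a b hab s ν hs hν hw
  have hgood : ∀ᵐ c ∂ν, (c.source = D.pt 0 ∧ c.target = D.pt 1 ∧ c.range ⊆ closure D.carrier) ∧
      (∃ e : C(I, ℂ), Injective e ∧ range e = c.range ∧ e 0 = D.pt 0 ∧ e 1 = D.pt 1) ∧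
      c.range ∩ frontier D.carrier ⊆ {D.pt 0, D.pt 1} := by
    filter_upwards [hfree, hshape] with c h₁ h₂
    exact ⟨h₁, h₂.1, h₂.2⟩
  obtain ⟨Z, hZsub, hZmeas, hZnull⟩ := exists_measurable_superset_of_null (ae_iff.1 hgood)
  have hMgood : ∀ c ∈ Zᶜ, (c.source = D.pt 0 ∧ c.target = D.pt 1 ∧ c.range ⊆ closure D.carrier) ∧
      (∃ e : C(I, ℂ), Injective e ∧ range e = c.range ∧ e 0 = D.pt 0 ∧ e 1 = D.pt 1) ∧
      c.range ∩ frontier D.carrier ⊆ {D.pt 0, D.pt 1} := fun c hc =>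
    Classical.byContradiction fun h => hc (hZsub h)
  have hMmeas : MeasurableSet Zᶜ := hZmeas.compl
  -- the source of a class in the event is `5r`-far from `q`
  have hsrc : ∀ c ∈ offTargetFarReturnEvent D q r η, c ∈ Zᶜ → 5 * r < dist (D.pt 0) q := by
    rintro c ⟨γ, hγc, v, T, t', -, -, -, -, hguard, -, -⟩ hc
    have h0 := hguard 0 bot_le
    have hsource : γ 0 = D.pt 0 := by
      have h := (hMgood c hc).1.1
      rwa [← hγc, CurveClass.source_mk] at h
    rwa [hsource] at h0
  -- it suffices to bound by every positive `α`
  suffices hmain : ∀ α : ℝ, 0 < α → ν (offTargetFarReturnEvent D q r η) ≤ ENNReal.ofReal α by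
    refine le_antisymm (ENNReal.le_of_forall_pos_le_add fun α hα _ => ?_) zero_le
    rw [zero_add, ← ENNReal.ofReal_coe_nnreal]
    exact hmain α (NNReal.coe_pos.2 hα)
  intro α hα
  by_cases hfar : 5 * r < dist (D.pt 0) q
  swap
  · -- degenerate centre: the event misses the good set
    calc ν (offTargetFarReturnEvent D q r η) ≤ ν Z := measure_mono fun c hc =>
          Classical.byContradiction fun hcZ => hfar (hsrc c hc hcZ)
      _ ≤ ENNReal.ofReal α := by rw [hZnull]; exact zero_le
  -- (3) radii and the compact core of the good set
  have hα2 : 0 < α / 2 := half_pos hα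
  obtain ⟨ρ, hρdef⟩ : ∃ ρ : ℝ, ρ = 3 * r / 2 := ⟨_, rfl⟩
  obtain ⟨ρ₀, hρ₀def⟩ : ∃ ρ₀ : ℝ, ρ₀ = 5 * r / 4 := ⟨_, rfl⟩
  obtain ⟨ρ₁, hρ₁def⟩ : ∃ ρ₁ : ℝ, ρ₁ = 9 * r / 8 := ⟨_, rfl⟩
  obtain ⟨R, hRdef⟩ : ∃ R : ℝ, R = 4 * r := ⟨_, rfl⟩
  obtain ⟨R', hR'def⟩ : ∃ R' : ℝ, R' = 3 * r := ⟨_, rfl⟩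
  obtain ⟨K, hKM, hK, hνK⟩ := hMmeas.exists_isCompact_sdiff_lt (measure_ne_top ν _)
    (ENNReal.ofReal_pos.2 hα2).ne'
  -- (4) the compact set of admissible pasts and its cover
  obtain ⟨hPc, hPshrink⟩ := hPC K hK q (D.pt 1) ρ ρ₁ η
  have hadm : ∀ p ∈ pastSet K q (D.pt 1) ρ ρ₁ η 0, ∃ π : Curve ℂ, CurveClass.mk π = p ∧
      IsAdmissiblePast D π q ρ := by
    rintro p ⟨γ, w, hγK, htip, -, hfarb, rfl⟩
    obtain ⟨⟨hsource, -, hrange⟩, harc, hfront⟩ := hMgood _ (hKM hγK)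
    rw [CurveClass.source_mk] at hsource
    rw [CurveClass.range_mk] at hrange harc hfront
    refine ⟨truncate γ w, rfl, hSA D γ w q ρ harc hfront hsource hrange ?_ ?_ ?_⟩
    · rw [mem_closedBall]
      linarith
    · intro h
      rw [h] at htip
      linarith
    · intro u hu h
      have h' := hfarb u hu
      rw [h, dist_self] at h'
      linarith
  have hρ : 0 < ρ := by rw [hρdef]; linarith
  have hρR' : ρ < R' := by rw [hρdef, hR'def]; linarith
  obtain ⟨t, πr, εr, ζr, δr, hspec, hcover⟩ :=
    exists_cover hU hab hρ hρR' hα2 (half_pos hr) hPc hadm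
  have hNopen : IsOpen (⋃ p ∈ t, ball p (ζr p)) := isOpen_biUnion fun _ _ => isOpen_ball
  obtain ⟨κ, hκ, hκsub⟩ := hPshrink _ hNopen hcover
  obtain ⟨ε', hε', hε'le⟩ := exists_pos_forall_le t (fun p => εr p / 4)
    fun p hp => by have := (hspec p hp).2.1; positivity
  obtain ⟨δ₁, hδ₁, hδ₁le⟩ := exists_pos_forall_le t δr fun p hp => (hspec p hp).2.2.2.2.2.1
  -- (6) the lattice bound, eventually along `δ → 0⁺`
  have hδ₂ : 0 < min (r / 4) (min ε' δ₁) := lt_min (by linarith) (lt_min hε' hδ₁)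
  have hev : ∀ᶠ δ in 𝓝[>] (0 : ℝ), SAW.law D.carrier δ (a δ) (b δ)
      {γ | Conf q ρ ρ₀ R ε' (⋃ p ∈ t, ball p (ζr p)) (latticeCurve γ)} ≤ ENNReal.ofReal (α / 2) := by
    filter_upwards [Ioo_mem_nhdsGT hδ₂] with δ hδ
    obtain ⟨hδ0, hδlt⟩ := hδ
    have hδr : δ < r / 4 := hδlt.trans_le (min_le_left _ _)
    have hδε : δ < ε' := hδlt.trans_le ((min_le_right _ _).trans (min_le_left _ _))
    have hδδ₁ : δ < δ₁ := hδlt.trans_le ((min_le_right _ _).trans (min_le_right _ _))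
    refine law_conf_le (R' := R') hLB hα2.le hδ0 (by rw [hρ₀def, hρdef]; linarith) t πr εr ζr
      (fun p hp => (hspec p hp).1) (fun p hp => ?_) (fun p hp => ?_) fun p hp t₀ ω htip hout hmem => ?_
    · have := (hspec p hp).2.2.2.2.1
      rw [hR'def, hRdef]
      linarith
    · have h₁ := (hspec p hp).2.2.2.1
      have h₂ := hε'le p hp
      linarith
    · exact (hspec p hp).2.2.2.2.2.2 δ hδ0 (hδδ₁.trans_le (hδ₁le p hp)) t₀ ω htip hout hmem
  -- (5) the event core lies in the open squeeze configuration
  have hsub : offTargetFarReturnEvent D q r η ∩ K ⊆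
      CurveClass.mk '' {γ | Conf q ρ ρ₀ R ε' (⋃ p ∈ t, ball p (ζr p)) γ} := by
    rintro c ⟨⟨γ, hγc, v, T, t', -, hTt, hT, -, hguard, hret, hoff⟩, hcK⟩
    refine ⟨γ, conf_of_return (ρ₁ := ρ₁) (κ := κ) hTt hT hguard hret (by rw [hρ₁def]; linarith)
      (by rw [hρ₁def, hρ₀def]; linarith) (by rw [hρ₀def, hρdef]; linarith) (by rw [hρdef]; linarith)
      (by rw [hRdef]; linarith) hε' hκ fun w' _ hwT hdw hfarq => ?_, hγc⟩
    refine hκsub ⟨γ, w', hγc ▸ hcK, hdw.le, hfarq, fun u hu => hoff u (hu.trans hwT), rfl⟩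
  -- (7) assemble
  have hport := measure_image_mk_le_limsup_law hs hw
    (isOpen_setOf_conf q ρ ρ₀ R ε' (⋃ p ∈ t, ball p (ζr p)) hNopen)
  have hcore : ν (offTargetFarReturnEvent D q r η ∩ K) ≤ ENNReal.ofReal (α / 2) :=
    (measure_mono hsub).trans (hport.trans (limsup_le_of_le (by isBoundedDefault) hev))
  have hsplit : offTargetFarReturnEvent D q r η ⊆
      (offTargetFarReturnEvent D q r η ∩ K ∪ (Zᶜ \ K)) ∪ Z := by
    intro c hc
    by_cases hcZ : c ∈ Z
    · exact Or.inr hcZ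
    · by_cases hcK : c ∈ K
      · exact Or.inl (Or.inl ⟨hc, hcK⟩)
      · exact Or.inl (Or.inr ⟨hcZ, hcK⟩)
  calc ν (offTargetFarReturnEvent D q r η)
      ≤ ν ((offTargetFarReturnEvent D q r η ∩ K ∪ (Zᶜ \ K)) ∪ Z) := measure_mono hsplit
    _ ≤ ν (offTargetFarReturnEvent D q r η ∩ K) + ν (Zᶜ \ K) + ν Z :=
        (measure_union_le _ _).trans (add_le_add (measure_union_le _ _) le_rfl)
    _ ≤ ENNReal.ofReal (α / 2) + ENNReal.ofReal (α / 2) + 0 :=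
        add_le_add (add_le_add hcore hνK.le) (le_of_eq hZnull)
    _ = ENNReal.ofReal α := by
        rw [add_zero, ← ENNReal.ofReal_add hα2.le hα2.le, add_halves]

/-! ## Closing (proved): far-return nullity + SHAPE give the core of the crux -/

/-- **Far-return nullity and SHAPE give the CORE of the crux** (`Negative.SimpleSubseqLimitsCore`:
`ν`-a.e. simple ∧ boundary clause) — lead c9's `Line.core_of_farReturnNull` (p154999) verbatim with the
boundary clause read off `RangeArc` instead of `rangeArc_of_avoidanceValues hAV`. Simplicity `ν`-a.e.:
the countably many far-return events with Gaussian-rational centre and positive rational radius are null,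
endpoints `a ≠ b` are free (`Negative.ae_source_target_range_of_weakLimitAlong`), and the guarded
Rohde–Schramm closing `FarPast.Passage.mem_simple_of_forall_notMem_farReturnEvent` applies. [folklore] -/
theorem core_of_farReturnNull_rangeArc (hN : FarReturnNull) (hRA : RangeArc) :
    SimpleSubseqLimitsCore := by
  intro D a b hab s ν hs hν hw
  haveI := hν
  have hL : IsSubseqLimit D a b s ν := ⟨hs, hν, hw⟩
  have hfree := ae_source_target_range_of_weakLimitAlong (ν := ν) hab hs hw
  haveI : Countable gaussRat := countable_gaussRat.to_subtype
  have hnull : ∀ᵐ c ∂ν, ∀ q : gaussRat, ∀ r : {x : ℚ // 0 < x},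
      c ∉ farReturnEvent (q : ℂ) (r : ℚ) := by
    rw [ae_all_iff]; intro q
    rw [ae_all_iff]; intro r
    have hr : (0 : ℝ) < ((r : ℚ) : ℝ) := by exact_mod_cast r.2
    exact measure_eq_zero_iff_ae_notMem.1 (hN D a b s ν hab hL q _ hr)
  have hshape := hRA D a b hab s ν hs hν hw
  filter_upwards [hfree, hnull, hshape] with c hc hn h2
  refine ⟨mem_simple_of_forall_notMem_farReturnEvent c (fun q hq r hr => ?_) ?_, h2.2⟩
  · exact hn ⟨q, hq⟩ ⟨r, hr⟩
  · rw [hc.1, hc.2.1]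
    exact fun h => absurd (D.pt_injective h) (by decide)

/-- **Route-neutral composition on the SHAPE input**: sequential slit avoidance and `RangeArc` give
the core of the crux, through the five landed stubs `stub_latticeBound`, `stub_prefixTiming`,
`stub_pastsCompact`, `stub_subArc`, `stub_endpoints` and the re-hosted transfer. [folklore] -/
theorem core_of_seqSlitAvoidance_rangeArc (h₁ : SequentialSlitAvoidance) (h₂ : RangeArc) :
    SimpleSubseqLimitsCore :=
  core_of_farReturnNull_rangeArc (stub_endpoints (transferCore_of_rangeArc stub_latticeBound
    stub_prefixTiming stub_pastsCompact stub_subArc h₁ h₂)) h₂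

/-! ## The route decl of stmt-CriticalPhenomena-4514 and the split glue -/

/-- The route decl `SAWExcursionCardy.SimpleSubseqLimits` (shared item stmt-CriticalPhenomena-4514) IS the
landed core `Negative.SimpleSubseqLimitsCore` (definitional). [folklore] -/
theorem excursionCardy_iff_core :
    Summit.CriticalPhenomena.SAWScalingLimit.Theses.SAWExcursionCardy.SimpleSubseqLimits ↔
      SimpleSubseqLimitsCore :=
  Iff.rfl

/-- **The crux of route SAWExcursionCardy from the two inputs** (by name). [folklore] -/
theorem excursionCardy_of_seqSlitAvoidance_rangeArc (h₁ : SequentialSlitAvoidance) (h₂ : RangeArc) :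
    Summit.CriticalPhenomena.SAWScalingLimit.Theses.SAWExcursionCardy.SimpleSubseqLimits :=
  excursionCardy_iff_core.2 (core_of_seqSlitAvoidance_rangeArc h₁ h₂)

/-! ## Read-backs of the route-file texts (definitional) and the split glue BY TEXT -/

/-- The route-file text of the child `SeqSlitAvoidance` IS `Transfer.SequentialSlitAvoidance`
(= item stmt-CriticalPhenomena-18169 of route SAWLoopFugacityFlow, verbatim). [folklore] -/
theorem seqSlitText_iff : ((∀ (D : Literature.Probability.RandomPlanarGeometry.DobrushinDomain) (a b : ℝ → Literature.Probability.LatticeModels.Site 2), Literature.Probability.RandomPlanarGeometry.SAW.IsEndpointApprox D a b → ∀ (π : Literature.Probability.RandomPlanarGeometry.Curve ℂ) (q : ℂ) (ρ R : ℝ), 0 < ρ → ρ < R → ((π 1 ∈ Metric.closedBall q ρ) ∧ Set.range (fun u : unitInterval => π u) ⊆ closure D.carrier ∧ ∃ e : C(unitInterval, ℂ), Function.Injective e ∧ Set.range e = Set.range (fun u : unitInterval => π u) ∧ e 0 = D.pt 0 ∧ ∀ u : unitInterval, e u ∈ frontier D.carrier → u = 0) → ∀ θ : ℝ, 0 < θ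 → ∃ ε : ℝ, 0 < ε ∧ ∀ (s : ℕ → ℝ) (t : ℕ → Literature.Probability.LatticeModels.Site 2) (ω : ∀ n : ℕ, Literature.Probability.RandomPlanarGeometry.SAW.DomainSAW D.carrier (s n) (a (s n)) (t n)), Filter.Tendsto s Filter.atTop (nhdsWithin 0 (Set.Ioi 0)) → (∀ n : ℕ, Literature.Probability.LatticeModels.meshPoint (s n) (t n) ∈ Metric.closedBall q ρ) → (∀ n : ℕ, ∀ x ∈ (ω n).walk.support.dropLast, Literature.Probability.LatticeModels.meshPoint (s n) x ∉ Metric.closedBall q ρ) → Filter.Tendsto (fun n => (ω n).curve) Filter.atTop (nhds (Literature.Probability.RandomPlanarGeometry.CurveClass.mk π)) → ∀ᶠ n in Filter.atTop, Literature.Probability.RandomPlanarGeometry.SAW.law D.carrier (s n) (a (s n)) (b (s n)) {γ : Literature.Probability.RandomPlanarGeometry.SAW.DomainSAW D.carrier (s n) (a (s n)) (b (s n)) | γ.walk.support.take ((ω n).length + 1) = (ω n).walk.support ∧ ∃ j : ℕ, (ω n).length ≤ j ∧ j ≤ γ.length ∧ ∃ z ∈ ((fun u : unitInterval => π u) ''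 {u : unitInterval | ∀ u' : unitInterval, u' ≤ u → R < dist (π u') q}), dist (Literature.Probability.LatticeModels.meshPoint (s n) (γ.walk.getVert j)) z < ε} ≤ ENNReal.ofReal θ * Literature.Probability.RandomPlanarGeometry.SAW.law D.carrier (s n) (a (s n)) (b (s n)) {γ : Literature.Probability.RandomPlanarGeometry.SAW.DomainSAW D.carrier (s n) (a (s n)) (b (s n)) | γ.walk.support.take ((ω n).length + 1) = (ω n).walk.support})) ↔ SequentialSlitAvoidance :=
  Iff.rfl

/-- The route-file text of the child `LimitRangeArc` IS `PastShadowing.Main.RangeArc`. [folklore] -/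
theorem rangeArcText_iff : ((∀ (D : Literature.Probability.RandomPlanarGeometry.DobrushinDomain) (a b : ℝ → Literature.Probability.LatticeModels.Site 2), Literature.Probability.RandomPlanarGeometry.SAW.IsEndpointApprox D a b → ∀ (s : ℕ → ℝ) (ν : MeasureTheory.Measure (Literature.Probability.RandomPlanarGeometry.CurveClass ℂ)), Filter.Tendsto s Filter.atTop (nhdsWithin 0 (Set.Ioi 0)) → MeasureTheory.IsProbabilityMeasure ν → (∀ f : BoundedContinuousFunction (Literature.Probability.RandomPlanarGeometry.CurveClass ℂ) ℝ, Filter.Tendsto (fun n => ∫ γ, f γ.curve ∂(Literature.Probability.RandomPlanarGeometry.SAW.law D.carrier (s n) (a (s n)) (b (s n)))) Filter.atTop (nhds (∫ x, f x ∂ν))) → ∀ᵐ γ ∂ν, (∃ e : C(unitInterval, ℂ), Function.Injective e ∧ Set.range e = γ.range ∧ e 0 = D.pt 0 ∧ e 1 = D.pt 1) ∧ γ.range ∩ frontier D.carrier ⊆ {D.pt 0, D.pt 1})) ↔ RangeArc :=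
  Iff.rfl

/-- **SPLIT GLUE** for `ledger route edit route-CriticalPhenomena-SAWExcursionCardy --split SimpleSubseqLimits
--glue-by`: child 1 (`SeqSlitAvoidance`, ORDER: conditional first-entrance far-slit avoidance, sequentially
continuous in the admissible limit past — research-open, = stmt-CriticalPhenomena-18169, the one open stub
`stub_seqSlitAvoidance` of the live line `slit-continuous-restriction`) → child 2 (`LimitRangeArc`, SHAPE:
value-free, order-blind, a consequence of the crux) → the crux BY NAME. [folklore] -/
theorem SimpleSubseqLimits_of_arcSubs : ((∀ (D : Literature.Probability.RandomPlanarGeometry.DobrushinDomain) (a b : ℝ → Literature.Probability.LatticeModels.Site 2), Literature.Probability.RandomPlanarGeometry.SAW.IsEndpointApprox D a b → ∀ (π : Literature.Probability.RandomPlanarGeometry.Curve ℂ) (q : ℂ) (ρ R : ℝ), 0 < ρ → ρ < R → ((π 1 ∈ Metric.closedBall q ρ) ∧ Set.range (fun u : unitInterval => π u) ⊆ closure D.carrier ∧ ∃ e : C(unitInterval, ℂ), Function.Injective e ∧ Set.range e = Set.range (fun u : unitInterval => π u) ∧ e 0 = D.pt 0 ∧ ∀ u : unitInterval, e u ∈ frontier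 D.carrier → u = 0) → ∀ θ : ℝ, 0 < θ → ∃ ε : ℝ, 0 < ε ∧ ∀ (s : ℕ → ℝ) (t : ℕ → Literature.Probability.LatticeModels.Site 2) (ω : ∀ n : ℕ, Literature.Probability.RandomPlanarGeometry.SAW.DomainSAW D.carrier (s n) (a (s n)) (t n)), Filter.Tendsto s Filter.atTop (nhdsWithin 0 (Set.Ioi 0)) → (∀ n : ℕ, Literature.Probability.LatticeModels.meshPoint (s n) (t n) ∈ Metric.closedBall q ρ) → (∀ n : ℕ, ∀ x ∈ (ω n).walk.support.dropLast, Literature.Probability.LatticeModels.meshPoint (s n) x ∉ Metric.closedBall q ρ) → Filter.Tendsto (fun n => (ω n).curve) Filter.atTop (nhds (Literature.Probability.RandomPlanarGeometry.CurveClass.mk π)) → ∀ᶠ n in Filter.atTop, Literature.Probability.RandomPlanarGeometry.SAW.law D.carrier (s n) (a (s n)) (b (s n)) {γ : Literature.Probability.RandomPlanarGeometry.SAW.DomainSAW D.carrier (s n) (a (s n)) (b (s n)) | γ.walk.support.take ((ω n).length + 1) = (ω n).walk.support ∧ ∃ j : ℕ, (ω n).length ≤ j ∧ j ≤ γ.length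 ∧ ∃ z ∈ ((fun u : unitInterval => π u) '' {u : unitInterval | ∀ u' : unitInterval, u' ≤ u → R < dist (π u') q}), dist (Literature.Probability.LatticeModels.meshPoint (s n) (γ.walk.getVert j)) z < ε} ≤ ENNReal.ofReal θ * Literature.Probability.RandomPlanarGeometry.SAW.law D.carrier (s n) (a (s n)) (b (s n)) {γ : Literature.Probability.RandomPlanarGeometry.SAW.DomainSAW D.carrier (s n) (a (s n)) (b (s n)) | γ.walk.support.take ((ω n).length + 1) = (ω n).walk.support})) → ((∀ (D : Literature.Probability.RandomPlanarGeometry.DobrushinDomain) (a b : ℝ → Literature.Probability.LatticeModels.Site 2), Literature.Probability.RandomPlanarGeometry.SAW.IsEndpointApprox D a b → ∀ (s : ℕ → ℝ) (ν : MeasureTheory.Measure (Literature.Probability.RandomPlanarGeometry.CurveClass ℂ)), Filter.Tendsto s Filter.atTop (nhdsWithin 0 (Set.Ioi 0)) → MeasureTheory.IsProbabilityMeasure ν → (∀ f : BoundedContinuousFunction (Literature.Probability.RandomPlanarGeometry.CurveClass ℂ) ℝ, Filter.Tendsto (fun n => ∫ γ, f γ.curve ∂(Literature.Probability.RandomPlanarGeometry.SAW.law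 D.carrier (s n) (a (s n)) (b (s n)))) Filter.atTop (nhds (∫ x, f x ∂ν))) → ∀ᵐ γ ∂ν, (∃ e : C(unitInterval, ℂ), Function.Injective e ∧ Set.range e = γ.range ∧ e 0 = D.pt 0 ∧ e 1 = D.pt 1) ∧ γ.range ∩ frontier D.carrier ⊆ {D.pt 0, D.pt 1})) →
    Summit.CriticalPhenomena.SAWScalingLimit.Theses.SAWExcursionCardy.SimpleSubseqLimits :=
  fun h₁ h₂ => excursionCardy_of_seqSlitAvoidance_rangeArc (seqSlitText_iff.1 h₁) (rangeArcText_iff.1 h₂)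

/-! ## The SHAPE child is necessary -/

/-- **SHAPE is a consequence of the core of the crux** (the child `LimitRangeArc` loses nothing): a simple
class has an injective representative with the same range, and under a subsequential limit its endpoints are
`ν`-a.e. the marked points (`Negative.ae_source_target_range_of_weakLimitAlong`). [folklore] -/
theorem rangeArc_of_core (h : SimpleSubseqLimitsCore) : RangeArc := by
  intro D a b hab s ν hs hν hw
  have hfree := ae_source_target_range_of_weakLimitAlong (ν := ν) hab hs hw
  filter_upwards [h D a b hab s ν hs hν hw, hfree] with c hc hst
  obtain ⟨hsimple, hfront⟩ := hc
  refine ⟨?_, hfront⟩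
  have hsrc : c.source = D.pt 0 := hst.1
  have htgt : c.target = D.pt 1 := hst.2.1
  obtain ⟨γ, hγ, rfl⟩ := hsimple
  refine ⟨γ.toContinuousMap, fun x y hxy => hγ (by simpa using hxy), ?_, ?_, ?_⟩
  · simp only [Curve.coe_toContinuousMap, CurveClass.range_mk]
    rfl
  · rw [CurveClass.source_mk] at hsrc
    simpa [Curve.source] using hsrc
  · rw [CurveClass.target_mk] at htgt
    simpa [Curve.target] using htgt

/-- **SHAPE is a consequence of the crux of route SAWExcursionCardy.** [folklore] -/
theorem rangeArc_of_excursionCardy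
    (h : Summit.CriticalPhenomena.SAWScalingLimit.Theses.SAWExcursionCardy.SimpleSubseqLimits) :
    RangeArc :=
  rangeArc_of_core (excursionCardy_iff_core.1 h)

end Summit.CriticalPhenomena.SAWScalingLimit.Theorems.SimpleSubseqLimits.SlitRestriction.ArcSplitEC

end
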